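import Literature.MathematicalPhysics.QuantumLattice.HubbardTTPrimeHartreeFockCeiling
import HarnessLib

/-!
# Grid-cell Fermi seas: a closed-form CEILING on the free `t–t'` energy density, hence the plain
# Hartree–Fock cap PLANE `e(t, t', U, n) ≤ t·A_S + t'·B_S + U (n/2)²`

Family `hubbard` (topic `MathematicalPhysics/QuantumLattice`; companion of
`HubbardTTPrimeHartreeFockCeiling`, whose table form `TTPrimeFree.energyDensityTT'_le_of_free_le` asks
for a certified `hi ≥ e(t, t', 0, n)`, and the upper-side twin of the Fermi-sea LOWER rows
`HubbardOneBodyKinematicRows.energyDensityTT'_ge_bathtub` / `HubbardFermiSeaCellRows`). Written for the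
certified fast layer of the Hubbard re-charter (crew hubbard-fast, seat atlas-2 "upper-edge transport",
2026-08-26): at `t' ≠ 0` the atlas caps of record are slopes-transported from `t' = 0` registry uppers;
a direct quasi-free ceiling is tighter at small `U`.

The instrument is a *grid-cell Fermi sea*: coarse-grain the Brillouin torus `[0, 2π)²` into the `M × M`
cells `[2πi/M, 2π(i+1)/M) × [2πj/M, 2π(j+1)/M)` and let `S` be ANY set of cells. On the torus of side
`L = M·Q` the plane waves whose momenta fall in the cells of `S`, filled with both spins, form a Slater
determinant of exactly `2|S|Q²` particles — density `n = 2|S|/M²` with NO rounding — of energy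
`2 Σ_{k ∈ S_L} ε(k) + U |S_L|²/L²` (`TTPrimeFree.hubbardTorusTT'_groundEnergy_le_freeFermion`,
Bach–Lieb–Solovej (2c.36)). The momentum sum over the `Q × Q` sub-grid of a cell is compared with the
cell AVERAGE of the band in closed form: the average of `cos` over `[p, p + h]` is `(sin(p+h) - sin p)/h`,
within `h` of `cos p` (§1), and these averages telescope along a cell side to
`σᵢ = (M/2π)(sin(2π(i+1)/M) - sin(2πi/M))` (`gridSigma`). With the CELL-AVERAGED BAND
`ε̄(i,j) = -2t(σᵢ + σⱼ) - 4t' σᵢ σⱼ` (`gridCellBand`) this gives, on every torus `L = M·Q`,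
`E_L(2|S|Q²)/L² ≤ (2/M²) Σ_{(i,j)∈S} ε̄(i,j) + U (|S|/M²)² + n(4|t| + 8|t'|)·2π/L` (§3), and `Q → ∞`
(`tendsto_energyDensityTT'_torus`) the thermodynamic-limit ceiling (§4, `energyDensityTT'_le_freeSea_grid`)

  `e(t, t', U, 2|S|/M²) ≤ (2/M²) Σ_{(i,j) ∈ S} ε̄(i,j) + U (|S|/M²)²`   (`U ≥ 0`, `|S| < M²`).

The right-hand side is AFFINE in `(t, t', U)` for a fixed sea (`energyDensityTT'_le_freeSea_plane`): ONE
certificate `S` is a cap plane over the whole coupling space at its density, and its `σᵢ` are enclosed by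
rationals from any sine table (`energyDensityTT'_le_of_freeSeaTable`, the row adapter an exact-rational
certificate discharges). Choosing `S` = the `|S|` cells of least `ε̄` recovers the sharp Fermi-sea value
up to `O(M⁻²)`; the theorems hold for every `S`. Everything is proved; the definitions (`gridSigma`,
`gridCellBand`, `seaIndex`, `seaOf`) have bodies; no named facts, no numerical input, no `decide`.

References: Bach–Lieb–Solovej, J. Stat. Phys. 76 (1994) 3, eq. (2c.36) (Slater determinants are
variational) [cite: BachLiebSolovej1994, eq. (2c.36)]; Lieb–Loss, *Analysis*, bathtub Thm. 1.14 (any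
admissible occupation bounds the minimum from above) [cite: LiebLoss1993, §8, Theorem 8.2]; Ruelle (1969)
§3.3 (thermodynamic limit along a subsequence of tori) [cite: Ruelle1969, §3.3].
-/

noncomputable section

open Finset Filter Topology

namespace Literature.MathematicalPhysics.QuantumLattice.TTPrimeFree

open Literature.Probability.LatticeModels ThermodynamicLimit

/-! ### §1 One-dimensional quadrature: the average of `cos` over a grid step -/

/-- `|cos p - (sin(p + h) - sin p)/h| ≤ h` for `0 < h ≤ 12`: the average of `cos` over `[p, p + h]` is
`(sin(h/2)/(h/2))·cos(p + h/2)` (`Real.sin_sub_sin`), `cos` is `1`-Lipschitz (`Real.abs_cos_sub_cos_le`) and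
`1 - x²/6 < sin x / x ≤ 1` (`Real.sin_gt_sub_cube`, `Real.sin_lt`). [folklore] -/
private theorem abs_cos_sub_stepAvg_le {p h : ℝ} (hh : 0 < h) (hh' : h ≤ 12) :
    |Real.cos p - (Real.sin (p + h) - Real.sin p) / h| ≤ h := by
  have hh2 : 0 < h / 2 := by positivity
  set s : ℝ := Real.sin (h / 2) / (h / 2) with hs
  have havg : (Real.sin (p + h) - Real.sin p) / h = s * Real.cos (p + h / 2) := by
    rw [Real.sin_sub_sin, hs, show (p + h - p) / 2 = h / 2 by ring,
      show (p + h + p) / 2 = p + h / 2 by ring]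
    field_simp
  have hs1 : s ≤ 1 := by rw [hs, div_le_one hh2]; exact (Real.sin_lt hh2).le
  have hs0 : 1 - (h / 2) ^ 2 / 6 ≤ s := by
    rw [hs, le_div_iff₀ hh2]
    have := Real.sin_gt_sub_cube hh2
    nlinarith
  have hlip : |Real.cos p - Real.cos (p + h / 2)| ≤ h / 2 := by
    have := Real.abs_cos_sub_cos_le p (p + h / 2)
    rwa [show p - (p + h / 2) = -(h / 2) by ring, abs_neg, abs_of_pos hh2] at this
  have hrest : |(1 - s) * Real.cos (p + h / 2)| ≤ (h / 2) ^ 2 / 6 := by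
    rw [abs_mul, abs_of_nonneg (by linarith : (0 : ℝ) ≤ 1 - s)]
    calc (1 - s) * |Real.cos (p + h / 2)| ≤ (h / 2) ^ 2 / 6 * 1 :=
          mul_le_mul (by linarith) (Real.abs_cos_le_one _) (abs_nonneg _) (by positivity)
      _ = (h / 2) ^ 2 / 6 := mul_one _
  rw [havg, show Real.cos p - s * Real.cos (p + h / 2) =
    (Real.cos p - Real.cos (p + h / 2)) + (1 - s) * Real.cos (p + h / 2) by ring]
  calc |Real.cos p - Real.cos (p + h / 2) + (1 - s) * Real.cos (p + h / 2)|
      ≤ |Real.cos p - Real.cos (p + h / 2)| + |(1 - s) * Real.cos (p + h / 2)| := abs_add_le _ _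
    _ ≤ h / 2 + (h / 2) ^ 2 / 6 := add_le_add hlip hrest
    _ ≤ h := by nlinarith

/-- The step average of `cos` is at most `1` in absolute value (`|sin x - sin y| ≤ |x - y|`). [folklore] -/
private theorem abs_stepAvg_le_one {p h : ℝ} (hh : 0 < h) : |(Real.sin (p + h) - Real.sin p) / h| ≤ 1 := by
  rw [abs_div, abs_of_pos hh, div_le_one hh]
  have := Real.abs_sin_sub_sin_le (p + h) p
  rwa [show p + h - p = h by ring, abs_of_pos hh] at this

/-- `x·y ≤ |x|·b` when `|y| ≤ b`. [folklore] -/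
private theorem mul_le_abs_mul_of_abs_le {x y b : ℝ} (hy : |y| ≤ b) : x * y ≤ |x| * b :=
  (le_abs_self _).trans (by rw [abs_mul]; exact mul_le_mul_of_nonneg_left hy (abs_nonneg _))

/-- **Point value versus step averages for the `t–t'` band.** With `A₀, A₁` the step averages of `cos`
at `p₀, p₁` (step `0 < h ≤ 12`):
`-t·2(cos p₀ + cos p₁) - t'·4 cos p₀ cos p₁ ≤ -t·2(A₀ + A₁) - t'·4 A₀ A₁ + (4|t| + 8|t'|) h`. [folklore] -/
private theorem band_le_stepAvg (t t' p₀ p₁ : ℝ) {h : ℝ} (hh : 0 < h) (hh' : h ≤ 12) :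
    -t * (2 * (Real.cos p₀ + Real.cos p₁)) + -t' * (4 * Real.cos p₀ * Real.cos p₁) ≤
      -t * (2 * ((Real.sin (p₀ + h) - Real.sin p₀) / h + (Real.sin (p₁ + h) - Real.sin p₁) / h)) +
        -t' * (4 * ((Real.sin (p₀ + h) - Real.sin p₀) / h) * ((Real.sin (p₁ + h) - Real.sin p₁) / h)) +
        (4 * |t| + 8 * |t'|) * h := by
  set A₀ := (Real.sin (p₀ + h) - Real.sin p₀) / h with hA₀
  set A₁ := (Real.sin (p₁ + h) - Real.sin p₁) / h with hA₁
  set d₀ := Real.cos p₀ - A₀ with hd₀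
  set d₁ := Real.cos p₁ - A₁ with hd₁
  have h0 : |d₀| ≤ h := abs_cos_sub_stepAvg_le hh hh'
  have h1 : |d₁| ≤ h := abs_cos_sub_stepAvg_le hh hh'
  -- `LHS = main + R`, `R` linear in the defects `d₀, d₁`
  have hR : -t * (2 * (Real.cos p₀ + Real.cos p₁)) + -t' * (4 * Real.cos p₀ * Real.cos p₁) =
      (-t * (2 * (A₀ + A₁)) + -t' * (4 * A₀ * A₁)) +
        ((-2 * t) * d₀ + (-2 * t) * d₁ + (-4 * t' * Real.cos p₁) * d₀ + (-4 * t' * A₀) * d₁) := by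
    rw [hd₀, hd₁]; ring
  rw [hR]
  have e1 : (-2 * t) * d₀ ≤ |-2 * t| * h := mul_le_abs_mul_of_abs_le h0
  have e2 : (-2 * t) * d₁ ≤ |-2 * t| * h := mul_le_abs_mul_of_abs_le h1
  have e3 : (-4 * t' * Real.cos p₁) * d₀ ≤ |-4 * t' * Real.cos p₁| * h := mul_le_abs_mul_of_abs_le h0
  have e4 : (-4 * t' * A₀) * d₁ ≤ |-4 * t' * A₀| * h := mul_le_abs_mul_of_abs_le h1
  have a1 : |-2 * t| = 2 * |t| := by rw [abs_mul, abs_neg, abs_two]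
  have a4 : ∀ z : ℝ, |z| ≤ 1 → |-4 * t' * z| * h ≤ 4 * |t'| * h := fun z hz => by
    refine mul_le_mul_of_nonneg_right ?_ hh.le
    rw [abs_mul, abs_mul, abs_neg, show |(4 : ℝ)| = 4 from abs_of_pos (by norm_num)]
    calc 4 * |t'| * |z| ≤ 4 * |t'| * 1 := by gcongr
      _ = 4 * |t'| := mul_one _
  rw [a1] at e1 e2
  nlinarith [a4 _ (Real.abs_cos_le_one p₁), a4 _ (abs_stepAvg_le_one (p := p₀) hh)]

/-! ### §2 The cell averages of the band -/

/-- `σ_M(i) = (M/2π)·(sin(2π(i+1)/M) - sin(2πi/M))`: the average of `cos` over the `i`-th side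
`[2πi/M, 2π(i+1)/M]` of the `M`-grid of `[0, 2π)`. [folklore] -/
def gridSigma (M i : ℕ) : ℝ :=
  (M : ℝ) / (2 * Real.pi) *
    (Real.sin (2 * Real.pi * ((i : ℝ) + 1) / M) - Real.sin (2 * Real.pi * (i : ℝ) / M))

/-- The CELL-AVERAGED `t–t'` band `ε̄(i,j) = -2t(σᵢ + σⱼ) - 4t' σᵢ σⱼ`: the mean over the grid cell
`(i, j)` of `ε(p) = -2t(cos p₁ + cos p₂) - 4t' cos p₁ cos p₂` (the product term separates).
[cite: XuEtAl2024, eq. (1)] -/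
def gridCellBand (M : ℕ) (t t' : ℝ) (c : Fin M × Fin M) : ℝ :=
  -t * (2 * (gridSigma M c.1 + gridSigma M c.2)) + -t' * (4 * gridSigma M c.1 * gridSigma M c.2)

/-- **Telescoping.** Along the `Q` sub-steps of the `i`-th cell side on the torus of side `L = M·Q`
(`h = 2π/L`): `Σ_{a<Q} (sin(2π(iQ+a+1)/L) - sin(2π(iQ+a)/L))/h = Q σ_M(i)`. [folklore] -/
private theorem sum_stepAvg_eq {M Q : ℕ} (hM : 0 < M) (hQ : 0 < Q) (i : ℕ) :
    ∑ a ∈ Finset.range Q,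
      (Real.sin (2 * Real.pi * (((i * Q + a : ℕ) : ℝ) + 1) / ((M * Q : ℕ) : ℝ)) -
          Real.sin (2 * Real.pi * ((i * Q + a : ℕ) : ℝ) / ((M * Q : ℕ) : ℝ))) /
        (2 * Real.pi / ((M * Q : ℕ) : ℝ)) = (Q : ℝ) * gridSigma M i := by
  have hMr : (0 : ℝ) < M := by exact_mod_cast hM
  have hQr : (0 : ℝ) < Q := by exact_mod_cast hQ
  rw [← Finset.sum_div]
  have htel : ∑ a ∈ Finset.range Q,
      (Real.sin (2 * Real.pi * (((i * Q + a : ℕ) : ℝ) + 1) / ((M * Q : ℕ) : ℝ)) -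
        Real.sin (2 * Real.pi * ((i * Q + a : ℕ) : ℝ) / ((M * Q : ℕ) : ℝ))) =
      Real.sin (2 * Real.pi * ((i : ℝ) + 1) / M) - Real.sin (2 * Real.pi * (i : ℝ) / M) := by
    have key := Finset.sum_range_sub (fun a : ℕ =>
      Real.sin (2 * Real.pi * ((i * Q + a : ℕ) : ℝ) / ((M * Q : ℕ) : ℝ))) Q
    have hrw : ∀ a : ℕ, (((i * Q + (a + 1) : ℕ) : ℝ)) = ((i * Q + a : ℕ) : ℝ) + 1 := by
      intro a; push_cast; ring
    simp only [hrw, Nat.add_zero] at key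
    rw [key]
    congr 2 <;> (push_cast; field_simp)
  rw [htel, gridSigma, show ((M * Q : ℕ) : ℝ) = (M : ℝ) * (Q : ℝ) by push_cast; ring]
  field_simp

/-! ### §3 The plane-wave sea of a cell set on the torus of side `M·Q` -/

/-- The plane-wave index of the sub-grid point `(a, b)` of the cell `(i, j)` on the torus of side `M·Q`:
coordinates `(a + Q·i, b + Q·j)` (`finProdFinEquiv`). [folklore] -/
def seaIndex (M Q : ℕ) (x : (Fin M × Fin M) × (Fin Q × Fin Q)) : FermionTorus 2 (M * Q) :=
  toLex ![finProdFinEquiv (x.1.1, x.2.1), finProdFinEquiv (x.1.2, x.2.2)]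

/-- `seaIndex` is injective. [folklore] -/
private theorem seaIndex_injective (M Q : ℕ) : Function.Injective (seaIndex M Q) := by
  intro x y hxy
  have h := congrArg ofLex hxy
  simp only [seaIndex, ofLex_toLex] at h
  have h0 := congrFun h 0
  have h1 := congrFun h 1
  simp only [Matrix.cons_val_zero, Matrix.cons_val_one] at h0 h1
  have e0 := finProdFinEquiv.injective h0
  have e1 := finProdFinEquiv.injective h1
  simp only [Prod.mk.injEq] at e0 e1
  exact Prod.ext (Prod.ext e0.1 e1.1) (Prod.ext e0.2 e1.2)

/-- The plane-wave sea of the cell set `S` on the torus of side `M·Q`: an embedded copy of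
`S × (Q × Q)`. [folklore] -/
def seaOf {M : ℕ} (Q : ℕ) (S : Finset (Fin M × Fin M)) : Finset (FermionTorus 2 (M * Q)) :=
  (S ×ˢ (Finset.univ : Finset (Fin Q × Fin Q))).map ⟨seaIndex M Q, seaIndex_injective M Q⟩

/-- `|S_L| = |S|·Q²`. [folklore] -/
private theorem card_seaOf {M : ℕ} (Q : ℕ) (S : Finset (Fin M × Fin M)) :
    (seaOf Q S).card = S.card * (Q * Q) := by
  rw [seaOf, Finset.card_map, Finset.card_product, Finset.card_univ, Fintype.card_prod, Fintype.card_fin]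

/-- The lattice momenta of a sea point: `p₀ = 2π(a + Q i)/L`, `p₁ = 2π(b + Q j)/L`. [folklore] -/
private theorem latticeMomentum_seaIndex {M Q : ℕ} [NeZero (M * Q)] (x : (Fin M × Fin M) × (Fin Q × Fin Q)) :
    latticeMomentum (M * Q) (seaIndex M Q x).toTorusSite 0 =
        2 * Real.pi * (((x.2.1 : ℕ) + Q * (x.1.1 : ℕ) : ℕ) : ℝ) / ((M * Q : ℕ) : ℝ) ∧
      latticeMomentum (M * Q) (seaIndex M Q x).toTorusSite 1 =
        2 * Real.pi * (((x.2.2 : ℕ) + Q * (x.1.2 : ℕ) : ℕ) : ℝ) / ((M * Q : ℕ) : ℝ) := by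
  have hv : ((ofLex (seaIndex M Q x) 0 : Fin (M * Q)) : ℕ) = x.2.1 + Q * x.1.1 ∧
      ((ofLex (seaIndex M Q x) 1 : Fin (M * Q)) : ℕ) = x.2.2 + Q * x.1.2 := by simp [seaIndex]
  refine ⟨?_, ?_⟩
  · simp only [latticeMomentum, FermionTorus.toTorusSite_apply, ZMod.val_natCast]
    rw [Nat.mod_eq_of_lt (ofLex (seaIndex M Q x) 0).isLt, hv.1]
  · simp only [latticeMomentum, FermionTorus.toTorusSite_apply, ZMod.val_natCast]
    rw [Nat.mod_eq_of_lt (ofLex (seaIndex M Q x) 1).isLt, hv.2]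

/-- **The momentum sum of a grid-cell sea versus the cell averages.** On the torus of side `L = M·Q`
(`M, Q ≥ 1`): `Σ_{k ∈ S_L} ε(k) ≤ Q² Σ_{c ∈ S} ε̄(c) + |S| Q² (4|t| + 8|t'|)·(2π/L)`. [folklore] -/
private theorem sum_ttBand_seaOf_le {M Q : ℕ} (hM : 0 < M) (hQ : 0 < Q) [NeZero (M * Q)] (t t' : ℝ)
    (S : Finset (Fin M × Fin M)) :
    ∑ k ∈ seaOf Q S, ttBand (M * Q) t t' k.toTorusSite ≤
      ((Q : ℝ) * Q) * ∑ c ∈ S, gridCellBand M t t' c +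
        (S.card : ℝ) * ((Q : ℝ) * Q) * ((4 * |t| + 8 * |t'|) * (2 * Real.pi / ((M * Q : ℕ) : ℝ))) := by
  have hL : (0 : ℝ) < ((M * Q : ℕ) : ℝ) := by exact_mod_cast Nat.mul_pos hM hQ
  set h : ℝ := 2 * Real.pi / ((M * Q : ℕ) : ℝ) with hh
  have hpos : 0 < h := by rw [hh]; positivity
  have hle : h ≤ 12 := by
    rw [hh, div_le_iff₀ hL]
    have h1 : (1 : ℝ) ≤ ((M * Q : ℕ) : ℝ) := by exact_mod_cast Nat.mul_pos hM hQ
    nlinarith [Real.pi_le_four]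
  -- step averages along a cell side, as functions of the sub-grid index
  set A : ℕ → ℕ → ℝ := fun i a =>
    (Real.sin (2 * Real.pi * (((i * Q + a : ℕ) : ℝ) + 1) / ((M * Q : ℕ) : ℝ)) -
        Real.sin (2 * Real.pi * ((i * Q + a : ℕ) : ℝ) / ((M * Q : ℕ) : ℝ))) / h with hA
  have hsumA : ∀ i : ℕ, ∑ a : Fin Q, A i a = (Q : ℝ) * gridSigma M i := fun i => by
    rw [Fin.sum_univ_eq_sum_range (fun a => A i a), hA]
    exact sum_stepAvg_eq hM hQ i
  -- pointwise bound at each sea point (§1)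
  have hpt : ∀ x : (Fin M × Fin M) × (Fin Q × Fin Q),
      ttBand (M * Q) t t' (seaIndex M Q x).toTorusSite ≤
        -t * (2 * (A x.1.1 x.2.1 + A x.1.2 x.2.2)) + -t' * (4 * A x.1.1 x.2.1 * A x.1.2 x.2.2) +
          (4 * |t| + 8 * |t'|) * h := by
    intro x
    obtain ⟨hp0, hp1⟩ := latticeMomentum_seaIndex (M := M) (Q := Q) x
    have hb := band_le_stepAvg t t' (latticeMomentum (M * Q) (seaIndex M Q x).toTorusSite 0)
      (latticeMomentum (M * Q) (seaIndex M Q x).toTorusSite 1) hpos hle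
    have hform : ∀ i a : ℕ, (Real.sin (2 * Real.pi * ((a + Q * i : ℕ) : ℝ) / ((M * Q : ℕ) : ℝ) + h) -
        Real.sin (2 * Real.pi * ((a + Q * i : ℕ) : ℝ) / ((M * Q : ℕ) : ℝ))) / h = A i a := by
      intro i a
      rw [hA, show ((a + Q * i : ℕ) : ℝ) = ((i * Q + a : ℕ) : ℝ) by push_cast; ring,
        show 2 * Real.pi * ((i * Q + a : ℕ) : ℝ) / ((M * Q : ℕ) : ℝ) + h =
          2 * Real.pi * (((i * Q + a : ℕ) : ℝ) + 1) / ((M * Q : ℕ) : ℝ) by rw [hh]; field_simp]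
    rw [ttBand, Fin.sum_univ_two, hp0, hp1]
    rw [hp0, hp1, hform x.1.1 x.2.1, hform x.1.2 x.2.2] at hb
    exact hb
  -- inner sum over the `Q × Q` sub-grid of a cell: telescoping (§2)
  have hin : ∀ c : Fin M × Fin M, ∑ y : Fin Q × Fin Q,
      (-t * (2 * (A c.1 y.1 + A c.2 y.2)) + -t' * (4 * A c.1 y.1 * A c.2 y.2) + (4 * |t| + 8 * |t'|) * h) =
      ((Q : ℝ) * Q) * gridCellBand M t t' c + ((Q : ℝ) * Q) * ((4 * |t| + 8 * |t'|) * h) := by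
    intro c
    have s0 : ∑ y : Fin Q × Fin Q, A c.1 y.1 = (Q : ℝ) * ((Q : ℝ) * gridSigma M c.1) := by
      rw [Fintype.sum_prod_type]
      simp only [Finset.sum_const, Finset.card_univ, Fintype.card_fin, nsmul_eq_mul]
      rw [← Finset.mul_sum, hsumA c.1]
    have s0' : ∑ y : Fin Q × Fin Q, A c.2 y.2 = (Q : ℝ) * ((Q : ℝ) * gridSigma M c.2) := by
      rw [Fintype.sum_prod_type]
      simp only [Finset.sum_const, Finset.card_univ, Fintype.card_fin, nsmul_eq_mul, hsumA c.2]
    have s2 : ∑ y : Fin Q × Fin Q, A c.1 y.1 * A c.2 y.2 =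
        ((Q : ℝ) * gridSigma M c.1) * ((Q : ℝ) * gridSigma M c.2) := by
      rw [Fintype.sum_prod_type, ← hsumA c.1, ← hsumA c.2, Finset.sum_mul_sum]
    have e1 : ∀ y : Fin Q × Fin Q,
        -t * (2 * (A c.1 y.1 + A c.2 y.2)) + -t' * (4 * A c.1 y.1 * A c.2 y.2) + (4 * |t| + 8 * |t'|) * h =
        (-2 * t) * A c.1 y.1 + (-2 * t) * A c.2 y.2 + (-4 * t') * (A c.1 y.1 * A c.2 y.2) +
          (4 * |t| + 8 * |t'|) * h := fun y => by ring
    simp only [e1]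
    rw [Finset.sum_add_distrib, Finset.sum_add_distrib, Finset.sum_add_distrib, ← Finset.mul_sum,
      ← Finset.mul_sum, ← Finset.mul_sum, s0, s0', s2, Finset.sum_const, Finset.card_univ,
      Fintype.card_prod, Fintype.card_fin, nsmul_eq_mul, gridCellBand]
    push_cast
    ring
  rw [seaOf, Finset.sum_map]
  simp only [Function.Embedding.coeFn_mk]
  refine (Finset.sum_le_sum fun x _ => hpt x).trans (le_of_eq ?_)
  rw [Finset.sum_product]
  simp only [hin]
  rw [Finset.sum_add_distrib, Finset.sum_const, ← Finset.mul_sum, nsmul_eq_mul]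
  ring

/-! ### §4 Thermodynamic limit: the grid-cell free-sea ceiling, its plane form and its row adapter -/

/-- **Grid-cell free-sea CEILING of the `t–t'` Hubbard energy density.** For `U ≥ 0`, `M ≥ 1` and any set
`S` of `M`-grid cells with `|S| < M²` (density `n = 2|S|/M² < 2`):

  `e(t, t', U, 2|S|/M²) ≤ (2/M²) Σ_{(i,j) ∈ S} (-2t(σᵢ + σⱼ) - 4t' σᵢ σⱼ) + U (|S|/M²)²`.

The doubly filled plane-wave sea over the cells of `S` on the tori `L = M·Q` (exact density, no rounding)
is a Slater determinant, variational by Bach–Lieb–Solovej (2c.36)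
(`hubbardTorusTT'_groundEnergy_le_freeFermion`); its kinetic energy per site exceeds the cell-average sum
by at most `n(4|t| + 8|t'|)·2π/L` (§3), and `Q → ∞` (`tendsto_energyDensityTT'_torus`).
[cite: BachLiebSolovej1994, eq. (2c.36)] [cite: Ruelle1969, §3.3] -/
theorem energyDensityTT'_le_freeSea_grid (t t' : ℝ) {U : ℝ} (hU : 0 ≤ U) {M : ℕ} (hM : 0 < M)
    (S : Finset (Fin M × Fin M)) (hS : S.card < M ^ 2) :
    energyDensityTT' t t' U (2 * (S.card : ℝ) / (M : ℝ) ^ 2) ≤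
      2 / (M : ℝ) ^ 2 * ∑ c ∈ S, gridCellBand M t t' c + U * ((S.card : ℝ) / (M : ℝ) ^ 2) ^ 2 := by
  set n : ℝ := 2 * (S.card : ℝ) / (M : ℝ) ^ 2 with hn
  have hMr : (0 : ℝ) < M := by exact_mod_cast hM
  have hn0 : 0 ≤ n := by positivity
  have hn2 : n < 2 := by
    rw [hn, div_lt_iff₀ (by positivity)]
    linarith [(show (S.card : ℝ) < (M : ℝ) ^ 2 by exact_mod_cast hS)]
  -- tori `L_q = M (q + 4)`
  set φ : ℕ → ℕ := fun q => M * (q + 4) with hφdef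
  have hφ : Tendsto φ atTop atTop := by
    refine tendsto_atTop_atTop.2 fun b => ⟨b, fun q hq => ?_⟩
    calc b ≤ q := hq
      _ ≤ q + 4 := by omega
      _ ≤ M * (q + 4) := Nat.le_mul_of_pos_left _ hM
  have limE : Tendsto (fun q => groundEnergy (hubbardTorusTT' (φ q) t t' U) (rectN n (φ q)) /
      ((φ q : ℕ) : ℝ) ^ 2) atTop (𝓝 (energyDensityTT' t t' U n)) :=
    (tendsto_energyDensityTT'_torus t t' hU hn0 hn2).comp hφ
  set c : ℝ := 2 / (M : ℝ) ^ 2 * ∑ c ∈ S, gridCellBand M t t' c + U * ((S.card : ℝ) / (M : ℝ) ^ 2) ^ 2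
    with hc
  set C : ℝ := n * ((4 * |t| + 8 * |t'|) * (2 * Real.pi)) with hC
  have limR : Tendsto (fun q => c + C / ((φ q : ℕ) : ℝ)) atTop (𝓝 c) := by
    have h1 : Tendsto (fun q => C / ((φ q : ℕ) : ℝ)) atTop (𝓝 0) :=
      tendsto_const_nhds.div_atTop (tendsto_natCast_atTop_atTop.comp hφ)
    simpa using tendsto_const_nhds.add h1
  refine le_of_tendsto_of_tendsto' limE limR fun q => ?_
  -- the finite-volume inequality on the torus of side `L = M * Q`, `Q = q + 4`
  set Q : ℕ := q + 4 with hQdef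
  have hQ : 0 < Q := by omega
  rw [show φ q = M * Q from rfl]
  haveI : NeZero (M * Q) := ⟨(Nat.mul_pos hM hQ).ne'⟩
  have hL3 : 3 ≤ M * Q := le_trans (by omega) (Nat.le_mul_of_pos_left _ hM)
  -- particle number: `rectN n L = 2 |S| Q²` exactly
  have hN : rectN n (M * Q) = 2 * (S.card * (Q * Q)) := by
    rw [rectN]
    congr 1
    have : n * (((M * Q : ℕ) : ℕ) : ℝ) ^ 2 / 2 = ((S.card * (Q * Q) : ℕ) : ℝ) := by
      rw [hn]; push_cast; field_simp
    rw [this, Nat.floor_natCast]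
  -- the Slater determinant over the sea (BLS (2c.36)) and the momentum-sum estimate of §3
  have hHF := hubbardTorusTT'_groundEnergy_le_freeFermion hL3 t t' U (seaOf Q S) (seaOf Q S)
  rw [card_seaOf, ← two_mul, ← hN, ← two_mul] at hHF
  have hsum := sum_ttBand_seaOf_le hM hQ t t' S
  have hL2 : (0 : ℝ) < (((M * Q : ℕ) : ℕ) : ℝ) ^ 2 := by positivity
  rw [div_le_iff₀ hL2]
  refine hHF.trans ?_
  have hcast : (((M * Q : ℕ) : ℕ) : ℝ) = (M : ℝ) * (Q : ℝ) := by push_cast; ring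
  rw [show (((S.card * (Q * Q) : ℕ)) : ℝ) = (S.card : ℝ) * ((Q : ℝ) * Q) by push_cast; ring]
  rw [hcast] at hsum ⊢
  have key : 2 * (((Q : ℝ) * Q) * ∑ c ∈ S, gridCellBand M t t' c +
        (S.card : ℝ) * ((Q : ℝ) * Q) * ((4 * |t| + 8 * |t'|) * (2 * Real.pi / ((M : ℝ) * Q)))) +
      U * ((S.card : ℝ) * ((Q : ℝ) * Q) * ((S.card : ℝ) * ((Q : ℝ) * Q))) / ((M : ℝ) * Q) ^ 2 =
      (c + C / ((M : ℝ) * Q)) * ((M : ℝ) * Q) ^ 2 := by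
    rw [hc, hC, hn]
    field_simp
    ring
  rw [← key]
  have h2 := mul_le_mul_of_nonneg_left hsum (show (0 : ℝ) ≤ 2 by norm_num)
  linarith

/-- **The cap PLANE of a grid-cell sea.** The ceiling is affine in the couplings: with
`A_S = (2/M²) Σ_S (-2)(σᵢ + σⱼ)` and `B_S = (2/M²) Σ_S (-4) σᵢ σⱼ`, for every `t, t'` and `U ≥ 0`,
`e(t, t', U, 2|S|/M²) ≤ t·A_S + t'·B_S + U (|S|/M²)²` — ONE sea certifies a cap over the whole
`(t, t', U)` space at its density. [cite: BachLiebSolovej1994, eq. (2c.36)] -/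
theorem energyDensityTT'_le_freeSea_plane (t t' : ℝ) {U : ℝ} (hU : 0 ≤ U) {M : ℕ} (hM : 0 < M)
    (S : Finset (Fin M × Fin M)) (hS : S.card < M ^ 2) :
    energyDensityTT' t t' U (2 * (S.card : ℝ) / (M : ℝ) ^ 2) ≤
      t * (2 / (M : ℝ) ^ 2 * ∑ c ∈ S, (-2) * (gridSigma M c.1 + gridSigma M c.2)) +
        t' * (2 / (M : ℝ) ^ 2 * ∑ c ∈ S, (-4) * (gridSigma M c.1 * gridSigma M c.2)) +
        U * ((S.card : ℝ) / (M : ℝ) ^ 2) ^ 2 := by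
  refine (energyDensityTT'_le_freeSea_grid t t' hU hM S hS).trans (le_of_eq ?_)
  simp only [gridCellBand]
  rw [Finset.mul_sum, Finset.mul_sum, Finset.mul_sum, Finset.mul_sum, Finset.mul_sum,
    ← Finset.sum_add_distrib]
  exact congrArg₂ (· + ·) (Finset.sum_congr rfl fun c _ => by ring) rfl

/-- **Row adapter (density and sine-table form).** For rational (or any real) `t, t'`, a cell set `S` of
the `M`-grid at density `n` (`n·M² = 2|S|`), enclosures `sl i ≤ σ_M(i) ≤ sh i` of the side averages
(`i < M`), cell bounds `ub c` valid on the enclosure box (`-2t(x+y) - 4t'xy ≤ ub c` for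
`x ∈ [sl c₁, sh c₁]`, `y ∈ [sl c₂, sh c₂]` — in a certificate: the sign-split corner values), and
`(2/M²) Σ_S ub ≤ hi`: the cap `e(t, t', U, n) ≤ hi + U (n/2)²` at every `U ≥ 0` — the `hfree` input of
`energyDensityTT'_le_of_free_le`, now at any `t'`. [cite: BachLiebSolovej1994, eq. (2c.36)] -/
theorem energyDensityTT'_le_of_freeSeaTable (t t' : ℝ) {U : ℝ} (hU : 0 ≤ U) {M : ℕ} (hM : 0 < M)
    (S : Finset (Fin M × Fin M)) (hS : S.card < M ^ 2) {n : ℝ} (hn : n * (M : ℝ) ^ 2 = 2 * S.card)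
    (sl sh : ℕ → ℝ) (hsl : ∀ i, i < M → sl i ≤ gridSigma M i) (hsh : ∀ i, i < M → gridSigma M i ≤ sh i)
    (ub : Fin M × Fin M → ℝ)
    (hub : ∀ c ∈ S, ∀ x y : ℝ, sl c.1 ≤ x → x ≤ sh c.1 → sl c.2 ≤ y → y ≤ sh c.2 →
      -t * (2 * (x + y)) + -t' * (4 * x * y) ≤ ub c)
    {hi : ℝ} (hhi : 2 / (M : ℝ) ^ 2 * ∑ c ∈ S, ub c ≤ hi) :
    energyDensityTT' t t' U n ≤ hi + U * (n / 2) ^ 2 := by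
  have hMr : (0 : ℝ) < M := by exact_mod_cast hM
  have hM2 : (0 : ℝ) < (M : ℝ) ^ 2 := by positivity
  have hn' : n = 2 * (S.card : ℝ) / (M : ℝ) ^ 2 := by rw [eq_div_iff hM2.ne']; exact hn
  have hn2 : n / 2 = (S.card : ℝ) / (M : ℝ) ^ 2 := by rw [hn']; ring
  rw [hn2, hn']
  refine (energyDensityTT'_le_freeSea_grid t t' hU hM S hS).trans ?_
  have hsum : ∑ c ∈ S, gridCellBand M t t' c ≤ ∑ c ∈ S, ub c := Finset.sum_le_sum fun c hc =>
    hub c hc _ _ (hsl _ c.1.isLt) (hsh _ c.1.isLt) (hsl _ c.2.isLt) (hsh _ c.2.isLt)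
  have h2 : 2 / (M : ℝ) ^ 2 * ∑ c ∈ S, gridCellBand M t t' c ≤ 2 / (M : ℝ) ^ 2 * ∑ c ∈ S, ub c :=
    mul_le_mul_of_nonneg_left hsum (by positivity)
  linarith

/-! ### §5 The fully polarised grid-cell sea: a ceiling UNIFORM in `U` (densities `≤ 1`) -/

/-- **Polarised grid-cell sea CEILING, uniform in `U`.** For `U ≥ 0`, `M ≥ 1` and any set `S` of
`M`-grid cells with `|S| ≤ M²` (density `n = |S|/M² ≤ 1`):

  `e(t, t', U, |S|/M²) ≤ (1/M²) Σ_{(i,j) ∈ S} (-2t(σᵢ + σⱼ) - 4t' σᵢ σⱼ)`,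

with NO `U`-term: the plane waves over the cells of `S` filled with ONE spin species only form a Slater
determinant without doubly occupied sites (`hubbardTorusTT'_groundEnergy_le_freeFermion` with the
down-spin sea EMPTY, Bach–Lieb–Solovej (2c.36)), on the even tori `L = M·2(q+2)` (so that the sector
`N_L(n) = 2⌊nL²/2⌋` is exactly `|S|·(L/M)²`); momentum sums vs cell averages as in §3, `q → ∞` as in §4.
This is the fully polarised (ferromagnetic) variational state: a cap on the interacting energy density
at EVERY `U ≥ 0`, hence on the whole open-above `U` axis of a material box.
[cite: BachLiebSolovej1994, eq. (2c.36)] [cite: Ruelle1969, §3.3] -/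
theorem energyDensityTT'_le_polarizedSea_grid (t t' : ℝ) {U : ℝ} (hU : 0 ≤ U) {M : ℕ} (hM : 0 < M)
    (S : Finset (Fin M × Fin M)) (hS : S.card ≤ M ^ 2) :
    energyDensityTT' t t' U ((S.card : ℝ) / (M : ℝ) ^ 2) ≤
      1 / (M : ℝ) ^ 2 * ∑ c ∈ S, gridCellBand M t t' c := by
  set n : ℝ := (S.card : ℝ) / (M : ℝ) ^ 2 with hn
  have hMr : (0 : ℝ) < M := by exact_mod_cast hM
  have hn0 : 0 ≤ n := by positivity
  have hn2 : n < 2 := by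
    rw [hn, div_lt_iff₀ (by positivity)]
    have : (S.card : ℝ) ≤ (M : ℝ) ^ 2 := by exact_mod_cast hS
    nlinarith
  -- even tori `L_q = M · 2(q + 2)`
  set φ : ℕ → ℕ := fun q => M * (2 * (q + 2)) with hφdef
  have hφ : Tendsto φ atTop atTop := by
    refine tendsto_atTop_atTop.2 fun b => ⟨b, fun q hq => ?_⟩
    calc b ≤ q := hq
      _ ≤ 2 * (q + 2) := by omega
      _ ≤ M * (2 * (q + 2)) := Nat.le_mul_of_pos_left _ hM
  have limE : Tendsto (fun q => groundEnergy (hubbardTorusTT' (φ q) t t' U) (rectN n (φ q)) /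
      ((φ q : ℕ) : ℝ) ^ 2) atTop (𝓝 (energyDensityTT' t t' U n)) :=
    (tendsto_energyDensityTT'_torus t t' hU hn0 hn2).comp hφ
  set c : ℝ := 1 / (M : ℝ) ^ 2 * ∑ c ∈ S, gridCellBand M t t' c with hc
  set C : ℝ := n * ((4 * |t| + 8 * |t'|) * (2 * Real.pi)) with hC
  have limR : Tendsto (fun q => c + C / ((φ q : ℕ) : ℝ)) atTop (𝓝 c) := by
    have h1 : Tendsto (fun q => C / ((φ q : ℕ) : ℝ)) atTop (𝓝 0) :=
      tendsto_const_nhds.div_atTop (tendsto_natCast_atTop_atTop.comp hφ)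
    simpa using tendsto_const_nhds.add h1
  refine le_of_tendsto_of_tendsto' limE limR fun q => ?_
  -- the finite-volume inequality on the torus of side `L = M * Q`, `Q = 2 (q + 2)`
  set Q : ℕ := 2 * (q + 2) with hQdef
  have hQ : 0 < Q := by omega
  rw [show φ q = M * Q from rfl]
  haveI : NeZero (M * Q) := ⟨(Nat.mul_pos hM hQ).ne'⟩
  have hL3 : 3 ≤ M * Q := le_trans (by omega) (Nat.le_mul_of_pos_left _ hM)
  -- particle number: `rectN n L = |S| Q²` exactly (`Q` even)
  have hN : rectN n (M * Q) = S.card * (Q * Q) := by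
    rw [rectN]
    have : n * (((M * Q : ℕ) : ℕ) : ℝ) ^ 2 / 2 = ((S.card * (2 * (q + 2) ^ 2) : ℕ) : ℝ) := by
      rw [hn, hQdef]; push_cast; field_simp
    rw [this, Nat.floor_natCast, hQdef]
    all_goals ring
  -- the one-species Slater determinant over the sea (BLS (2c.36)): no interaction term
  have hHF := hubbardTorusTT'_groundEnergy_le_freeFermion hL3 t t' U (seaOf Q S) ∅
  simp only [Finset.card_empty, add_zero, Finset.sum_empty, Nat.cast_zero, mul_zero, zero_div]
    at hHF
  rw [card_seaOf, ← hN] at hHF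
  have hsum := sum_ttBand_seaOf_le hM hQ t t' S
  have hL2 : (0 : ℝ) < (((M * Q : ℕ) : ℕ) : ℝ) ^ 2 := by positivity
  rw [div_le_iff₀ hL2]
  refine hHF.trans ?_
  have hcast : (((M * Q : ℕ) : ℕ) : ℝ) = (M : ℝ) * (Q : ℝ) := by push_cast; ring
  rw [hcast] at hsum ⊢
  have key : ((Q : ℝ) * Q) * ∑ c ∈ S, gridCellBand M t t' c +
        (S.card : ℝ) * ((Q : ℝ) * Q) * ((4 * |t| + 8 * |t'|) * (2 * Real.pi / ((M : ℝ) * Q))) =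
      (c + C / ((M : ℝ) * Q)) * ((M : ℝ) * Q) ^ 2 := by
    rw [hc, hC, hn]
    field_simp
  rw [← key]
  exact hsum

/-- **The `U`-uniform cap PLANE of a polarised grid-cell sea.** With `A_S = (1/M²) Σ_S (-2)(σᵢ + σⱼ)` and
`B_S = (1/M²) Σ_S (-4) σᵢ σⱼ`: `e(t, t', U, |S|/M²) ≤ t·A_S + t'·B_S` for every `t, t'` and every `U ≥ 0`.
[cite: BachLiebSolovej1994, eq. (2c.36)] -/
theorem energyDensityTT'_le_polarizedSea_plane (t t' : ℝ) {U : ℝ} (hU : 0 ≤ U) {M : ℕ} (hM : 0 < M)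
    (S : Finset (Fin M × Fin M)) (hS : S.card ≤ M ^ 2) :
    energyDensityTT' t t' U ((S.card : ℝ) / (M : ℝ) ^ 2) ≤
      t * (1 / (M : ℝ) ^ 2 * ∑ c ∈ S, (-2) * (gridSigma M c.1 + gridSigma M c.2)) +
        t' * (1 / (M : ℝ) ^ 2 * ∑ c ∈ S, (-4) * (gridSigma M c.1 * gridSigma M c.2)) := by
  refine (energyDensityTT'_le_polarizedSea_grid t t' hU hM S hS).trans (le_of_eq ?_)
  simp only [gridCellBand]
  rw [Finset.mul_sum, Finset.mul_sum, Finset.mul_sum, Finset.mul_sum, Finset.mul_sum,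
    ← Finset.sum_add_distrib]
  exact Finset.sum_congr rfl fun c _ => by ring

/-- **Row adapter (polarised sea, sine-table form).** For a cell set `S` of the `M`-grid at density `n`
(`n·M² = |S|`, so `n ≤ 1`), enclosures `sl i ≤ σ_M(i) ≤ sh i` (`i < M`), cell bounds `ub c` valid on the
enclosure box, and `(1/M²) Σ_S ub ≤ hi`: the cap `e(t, t', U, n) ≤ hi` at EVERY `U ≥ 0` — the certificate
shape of `energyDensityTT'_le_of_freeSeaTable` with one spin species and no `U (n/2)²` term.
[cite: BachLiebSolovej1994, eq. (2c.36)] -/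
theorem energyDensityTT'_le_of_polarizedSeaTable (t t' : ℝ) {U : ℝ} (hU : 0 ≤ U) {M : ℕ} (hM : 0 < M)
    (S : Finset (Fin M × Fin M)) (hS : S.card ≤ M ^ 2) {n : ℝ} (hn : n * (M : ℝ) ^ 2 = S.card)
    (sl sh : ℕ → ℝ) (hsl : ∀ i, i < M → sl i ≤ gridSigma M i) (hsh : ∀ i, i < M → gridSigma M i ≤ sh i)
    (ub : Fin M × Fin M → ℝ)
    (hub : ∀ c ∈ S, ∀ x y : ℝ, sl c.1 ≤ x → x ≤ sh c.1 → sl c.2 ≤ y → y ≤ sh c.2 →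
      -t * (2 * (x + y)) + -t' * (4 * x * y) ≤ ub c)
    {hi : ℝ} (hhi : 1 / (M : ℝ) ^ 2 * ∑ c ∈ S, ub c ≤ hi) :
    energyDensityTT' t t' U n ≤ hi := by
  have hMr : (0 : ℝ) < M := by exact_mod_cast hM
  have hM2 : (0 : ℝ) < (M : ℝ) ^ 2 := by positivity
  have hn' : n = (S.card : ℝ) / (M : ℝ) ^ 2 := by rw [eq_div_iff hM2.ne']; exact hn
  rw [hn']
  refine (energyDensityTT'_le_polarizedSea_grid t t' hU hM S hS).trans ?_
  have hsum : ∑ c ∈ S, gridCellBand M t t' c ≤ ∑ c ∈ S, ub c := Finset.sum_le_sum fun c hc =>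
    hub c hc _ _ (hsl _ c.1.isLt) (hsh _ c.1.isLt) (hsl _ c.2.isLt) (hsh _ c.2.isLt)
  have h2 : 1 / (M : ℝ) ^ 2 * ∑ c ∈ S, gridCellBand M t t' c ≤ 1 / (M : ℝ) ^ 2 * ∑ c ∈ S, ub c :=
    mul_le_mul_of_nonneg_left hsum (by positivity)
  linarith

end Literature.MathematicalPhysics.QuantumLattice.TTPrimeFree

end
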